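/-
# A two-`p`-member triple surviving TPP + walls + the exponent-`3` floor

Cell B2b-5 (`b2b-lgcu-borel`, generation 14), supporting the crux `SubgroupIdentityDesigns`
(`stmt-MatrixMultiplication-14079`) of the route `LevelGradedCohnUmans`.

HONEST FRAMING.  VALUE = THEOREM (sharpness of the structural laws of the decidable
`(m,k) = (2,1)` cell) — NOT summit progress.  Nothing here bears on `ω`.
-/
import Summits.MatrixMultiplication.MatrixMultiplication.Theorems.SubgroupIdentityDesigns.Negative.FrameSurvivorGroups
import Summits.MatrixMultiplication.MatrixMultiplication.Theorems.SubgroupIdentityDesigns.Negative.VolumeExceedsOrder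

/-!
## What is proved

`frame_survivor`: for every prime `p ≡ 3 (mod 4)`, `p ≥ 7`, the triple
`K₁ = {[[±1, x], [0, 1]]}`, `K₂ = {[[1, 0], [y, ±1]]}`, `S = (Q × Q) ⋊ ⟨w⟩`
(`Q` = non-zero squares; `FrameSurvivorGroups`) of subgroups of `GL₂(𝔽_p)`
* satisfies the subgroup TPP (`-1 ∉ Q` is exactly where `p ≡ 3 (mod 4)` enters),
* has `|K₁| = |K₂| = 2p` (TWO members of order divisible by `p`), `2|S| = (p-1)²`, `p ∤ |S|`,
* has volume `V = |K₁||K₂||S| = 2p²(p-1)²` STRICTLY ABOVE the exact level-one floor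
  `1 + p³ + (p-2)(p+1)³` at exponent `3` (`DecoratedSylowNoGo.budget_two_ge` with `s = 3`, i.e.
  `ε = 1`; by `LevelOneExact` these `p` characters are all of `Irr ∩ F₁`, so this is the census's
  volume test at `ε = 1`),
* and passes all three pair WALLS of `StandardLines` (`|Hᵢ||Hⱼ| + 2p ≤ (p+1)(p²-1)`).

Consequence for the census of the `(2,1)` cell.  After the Sylow-frame reduction
(`TwoSylowLaw`, `SylowFrames`: two `p`-members are simultaneously conjugate into
`U⁺ ≤ K₁ ≤ B⁺`, `U⁻ ≤ K₂ ≤ B⁻`), subgroup TPP + walls + `p`-structure do NOT push the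
two-`p`-member case below the budget, for infinitely many `p`: closing it needs the identity
DESIGN beyond the walls — concretely a no-design theorem for this family (at `p = 7` it is the
gen-13 census's largest TPP + walls survivor, `V = 3528`, and carries no level-`1` design by LP).

Sorry-free; no new definitions.
-/

set_option linter.dupNamespace false

noncomputable section

open scoped BigOperators Classical
open Summit.MatrixMultiplication.MatrixMultiplication.Theorems.LieRankDesigns.Negative
  (GLm Mat budget)

namespace Summit.MatrixMultiplication.MatrixMultiplication.Theorems.SubgroupIdentityDesigns.Negative

section FrameSurvivor

open Literature.Barriers.MatrixMultiplication (SubgroupTPP)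

variable {p : ℕ} [hp : Fact p.Prime]

/-- **TPP of the frame survivor.**  `K₁ = {[[±1,x],[0,1]]}`, `K₂ = {[[1,0],[y,±1]]}` and any
subgroup `S` of square-monomial matrices satisfy the subgroup TPP when `-1` is a non-square. -/
theorem frame_tpp (hnsq : ¬ IsSquare (-1 : ZMod p)) {K₁ K₂ S : Subgroup (GLm p 2)}
    (hK₁ : ∀ g : GLm p 2, g ∈ K₁ ↔ (g : Mat p 2) 1 0 = 0 ∧ (g : Mat p 2) 1 1 = 1 ∧
      ((g : Mat p 2) 0 0 = 1 ∨ (g : Mat p 2) 0 0 = -1))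
    (hK₂ : ∀ g : GLm p 2, g ∈ K₂ ↔ (g : Mat p 2) 0 1 = 0 ∧ (g : Mat p 2) 0 0 = 1 ∧
      ((g : Mat p 2) 1 1 = 1 ∨ (g : Mat p 2) 1 1 = -1))
    (hS : ∀ g : GLm p 2, g ∈ S →
      ((g : Mat p 2) 0 1 = 0 ∧ (g : Mat p 2) 1 0 = 0 ∧
        IsSquare ((g : Mat p 2) 0 0) ∧ IsSquare ((g : Mat p 2) 1 1)) ∨
      ((g : Mat p 2) 0 0 = 0 ∧ (g : Mat p 2) 1 1 = 0 ∧
        IsSquare ((g : Mat p 2) 0 1) ∧ IsSquare ((g : Mat p 2) 1 0))) :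
    SubgroupTPP K₁ K₂ S := by
  obtain ⟨e00, e01, e10, e11⟩ := gl2_one_apply (p := p)
  rw [VolumeExceedsOrder.subgroupTPP_iff]
  constructor
  · intro a ha ha'
    obtain ⟨a10, a11, -⟩ := (hK₁ a).1 ha
    obtain ⟨a01, a00, -⟩ := (hK₂ a).1 ha'
    exact gl2_ext (a00.trans e00.symm) (a01.trans e01.symm) (a10.trans e10.symm)
      (a11.trans e11.symm)
  · intro a ha b hb hab
    obtain ⟨a10, a11, ha0⟩ := (hK₁ a).1 ha
    obtain ⟨b01, b00, hb1⟩ := (hK₂ b).1 hb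
    have m00 : ((a * b : GLm p 2) : Mat p 2) 0 0 =
        (a : Mat p 2) 0 0 + (a : Mat p 2) 0 1 * (b : Mat p 2) 1 0 := by
      rw [gl2_mul_apply, b00]; ring
    have m01 : ((a * b : GLm p 2) : Mat p 2) 0 1 = (a : Mat p 2) 0 1 * (b : Mat p 2) 1 1 := by
      rw [gl2_mul_apply, b01]; ring
    have m10 : ((a * b : GLm p 2) : Mat p 2) 1 0 = (b : Mat p 2) 1 0 := by
      rw [gl2_mul_apply, a10, a11]; ring
    have m11 : ((a * b : GLm p 2) : Mat p 2) 1 1 = (b : Mat p 2) 1 1 := by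
      rw [gl2_mul_apply, a10, a11, b01]; ring
    have hb1ne : (b : Mat p 2) 1 1 ≠ 0 := by
      rcases hb1 with h | h <;> rw [h]
      · exact one_ne_zero
      · exact neg_ne_zero.2 one_ne_zero
    rcases hS _ hab with ⟨s01, s10, s00, s11⟩ | ⟨-, s11, -, -⟩
    · rw [m10] at s10
      rw [m01] at s01
      have a01 : (a : Mat p 2) 0 1 = 0 := by
        rcases mul_eq_zero.1 s01 with h | h
        · exact h
        · exact absurd h hb1ne
      rw [m00, a01, zero_mul, add_zero] at s00
      rw [m11] at s11
      have a00 : (a : Mat p 2) 0 0 = 1 := by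
        rcases ha0 with h | h
        · exact h
        · rw [h] at s00
          exact absurd s00 hnsq
      have b11 : (b : Mat p 2) 1 1 = 1 := by
        rcases hb1 with h | h
        · exact h
        · rw [h] at s11
          exact absurd s11 hnsq
      exact ⟨gl2_ext (a00.trans e00.symm) (a01.trans e01.symm) (a10.trans e10.symm)
          (a11.trans e11.symm),
        gl2_ext (b00.trans e00.symm) (b01.trans e01.symm) (s10.trans e10.symm)
          (b11.trans e11.symm)⟩
    · rw [m11] at s11
      exact absurd s11 hb1ne

/-- **The frame survivor.**  For a prime `p ≡ 3 (mod 4)`, `p ≥ 7`: a subgroup TPP triple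
`(K₁, K₂, S)` in `GL₂(𝔽_p)` with `|K₁| = |K₂| = 2p`, `2|S| = (p-1)²`, `p ∤ |S|`, whose volume
`2p²(p-1)²` exceeds the exact level-one floor `1 + p³ + (p-2)(p+1)³` at exponent `3` and which
satisfies the three pair walls `|Hᵢ||Hⱼ| + 2p ≤ (p+1)(p²-1)` of `StandardLines`. -/
theorem frame_survivor (hp4 : p % 4 = 3) (hp7 : 7 ≤ p) :
    ∃ H₁ H₂ H₃ : Subgroup (GLm p 2), SubgroupTPP H₁ H₂ H₃ ∧
      Nat.card H₁ = 2 * p ∧ Nat.card H₂ = 2 * p ∧ 2 * Nat.card H₃ = (p - 1) ^ 2 ∧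
      ¬ p ∣ Nat.card H₃ ∧
      1 + p ^ 3 + (p - 2) * (p + 1) ^ 3 < Nat.card H₁ * Nat.card H₂ * Nat.card H₃ ∧
      Nat.card H₁ * Nat.card H₃ + 2 * p ≤ (p + 1) * (p ^ 2 - 1) ∧
      Nat.card H₁ * Nat.card H₂ + 2 * p ≤ (p + 1) * (p ^ 2 - 1) ∧
      Nat.card H₂ * Nat.card H₃ + 2 * p ≤ (p + 1) * (p ^ 2 - 1) := by
  obtain ⟨K₁, hK₁, cK₁⟩ := exists_signedUpper_subgroup hp4
  obtain ⟨K₂, hK₂, cK₂⟩ := exists_signedLower_subgroup hp4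
  obtain ⟨S, hS, cS⟩ := exists_sqMonomial_subgroup hp4
  have htpp : SubgroupTPP K₁ K₂ S :=
    frame_tpp (not_isSquare_neg_one_of_mod_four hp4) hK₁ hK₂ (fun g hg => (hS g).1 hg)
  -- arithmetic: `p = 2q + 1 = 2r + 3`, `|S| = 2q²`
  obtain ⟨q, hq⟩ : ∃ q, p / 2 = q := ⟨_, rfl⟩
  rw [hq] at cS
  have hpq : p = 2 * q + 1 := by omega
  obtain ⟨r, hr⟩ : ∃ r, q = r + 1 := ⟨q - 1, by omega⟩
  have hr2 : 2 ≤ r := by omega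
  have hp21 : p ^ 2 - 1 = (p + 1) * (p - 1) := by
    simpa using Nat.sq_sub_sq p 1
  have hpm1 : p - 1 = 2 * r + 2 := by omega
  have hpm2 : p - 2 = 2 * r + 1 := by omega
  have hpr : p = 2 * r + 3 := by omega
  have h2 : 2 * r ≤ r * r := Nat.mul_le_mul_right r hr2
  have h3 : 2 * (r * r) ≤ r * (r * r) := Nat.mul_le_mul_right (r * r) hr2
  have h4 : 2 * (r * (r * r)) ≤ r * (r * (r * r)) := Nat.mul_le_mul_right (r * (r * r)) hr2
  refine ⟨K₁, K₂, S, htpp, cK₁, cK₂, ?_, ?_, ?_, ?_, ?_, ?_⟩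
  · rw [cS, hpm1, hr]
    ring
  · rw [cS]
    intro h
    rcases (Nat.Prime.dvd_mul hp.out).1 h with h2' | hqq
    · have := Nat.le_of_dvd two_pos h2'
      omega
    · rcases (Nat.Prime.dvd_mul hp.out).1 hqq with h' | h' <;>
      · have := Nat.le_of_dvd (by omega) h'
        omega
  · rw [cK₁, cK₂, cS, hpm2, hr, hpr]
    nlinarith [h2, h3, h4]
  · rw [cK₁, cS, hp21, hpm1, hr, hpr]
    nlinarith [h2, h3]
  · rw [cK₁, cK₂, hp21, hpm1, hpr]
    nlinarith [h2, h3]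
  · rw [cK₂, cS, hp21, hpm1, hr, hpr]
    nlinarith [h2, h3]

end FrameSurvivor

end Summit.MatrixMultiplication.MatrixMultiplication.Theorems.SubgroupIdentityDesigns.Negative
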